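import Mathlib
import HarnessLib
import Literature.MathematicalPhysics.StatisticalMechanics.LinearisedMapSingleBlock
import Literature.MathematicalPhysics.StatisticalMechanics.WeightedNormBounds

/-!
# Lemma 10.4 of [ABKM19] (pointwise part): absorbing `(1 + |φ|_{k+1,B'})⁵ w_{k:k+1}` into
# `w_{k+1}^{B'}` by (w9), `|G(B)|_{k+1,B',T_φ} ≤ C' c_G ‖K‖_{k,B} w_{k+1}^{B'}(φ)`

[ABKM19] (10.13): by Theorem 7.1 (w9), `(1 + |φ|_{k+1,B'})⁵ w_{k:k+1}^{B'}(φ) ≤ C' w_{k+1}^{B'}(φ)` with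
`C' = sup_{x ≥ 0} (1+x)⁵ e^{−x²/2}`, and `|φ|_{k+1,B} ≤ |φ|_{k+1,B'}`, `w_{k:k+1}^B ≤ w_{k:k+1}^{B'}` for
`B ⊆ B'`; so Lemma 10.3 gives `|G(B)|_{k+1,B',T_φ} ≤ C' c_G w_{k+1}^{B'}(φ) ‖K‖_{k,B}`.  Here:

* `one_add_pow_five_le` — `(1 + x)⁵ ≤ 1536 · e^{x²/2}` for `x ≥ 0` (an admissible value of `C'`);
* **`tayNormLE_Pi2Rem_of_w9`** — from the hypotheses of `tayNorm_Pi2Rem_le_weighted` (gauge set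
  `S = B*`), a larger gauge set `S' ⊇ S` (`= B'*`) and the (w9)-type hypothesis
  `e^{‖T'_{S'}φ‖²/2} w(φ) ≤ w'(φ)`:  `TayNormLE (T'_{S'}) r₀ w' (F − Π₂F(B)) (1536 · C_F · c_G)`.

Everything here is proved; no named fact.

## References
* S. Adams, S. Buchholz, R. Kotecký, S. Müller, arXiv:1910.13564, Lemma 10.4 (10.13), Theorem 7.1
  (w9) [AdamsBuchholzKoteckyMuller2019].
-/

noncomputable section

namespace Literature.MathematicalPhysics.StatisticalMechanics.GradientRG

open Finset
open Literature.MathematicalPhysics.QuantumFieldTheory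

/-! ## The constant `C' = sup (1+x)⁵ e^{−x²/2}` -/

/-- **`(1 + x)⁵ ≤ 1536 · e^{x²/2}`** for `x ≥ 0` (so `C' ≤ 1536` in [ABKM19] Lemma 10.4): for `x ≤ 1`
the left side is `≤ 32`, for `x ≥ 1` it is `≤ 32x⁶ = 1536 · (x²/2)³/3!`.
[cite: AdamsBuchholzKoteckyMuller2019, Lemma 10.4 (the constant C')] -/
theorem one_add_pow_five_le {x : ℝ} (hx : 0 ≤ x) : (1 + x) ^ 5 ≤ 1536 * Real.exp (x ^ 2 / 2) := by
  have hy : 0 ≤ x ^ 2 / 2 := by positivity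
  have hexp : 1 + x ^ 2 / 2 + (x ^ 2 / 2) ^ 2 / 2 + (x ^ 2 / 2) ^ 3 / 6 ≤ Real.exp (x ^ 2 / 2) := by
    have h := Real.sum_le_exp_of_nonneg hy 4
    simp only [Finset.sum_range_succ, Finset.sum_range_zero, Nat.factorial, pow_zero, pow_one,
      Nat.cast_one, zero_add] at h
    norm_num at h
    linarith
  rcases le_total x 1 with h1 | h1
  · have h2 : (1 + x) ^ 5 ≤ 2 ^ 5 := pow_le_pow_left₀ (by linarith) (by linarith) 5
    have h3 : (1 : ℝ) ≤ Real.exp (x ^ 2 / 2) := Real.one_le_exp hy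
    nlinarith
  · have h2 : (1 + x) ^ 5 ≤ (2 * x) ^ 5 := pow_le_pow_left₀ (by linarith) (by linarith) 5
    have h3 : x ^ 5 ≤ x ^ 6 := by
      rw [pow_succ]; exact le_mul_of_one_le_right (by positivity) h1
    nlinarith

/-! ## Lemma 10.4, pointwise -/

section SingleBlock

variable {𝕜 : Type*} [NormedField 𝕜] [NormedAlgebra ℝ 𝕜] [CompleteSpace 𝕜] {d M : ℕ} [NeZero M]

variable {a : Fin d → ZMod M} {B S S' : Finset (Fin d → ZMod M)} {p r₀ ρ' : ℕ}
  {𝔥 𝔥' R R' L κ C₁ : ℝ} {K : ((Fin d → ZMod M) → ℝ) → 𝕜}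

/-- **Lemma 10.4 (pointwise): `|G(B)|_{k+1,B',T_φ} ≤ 1536 c_G ‖K‖ w_{k+1}^{B'}(φ)`.**  In the setting
of `tayNorm_Pi2Rem_le_weighted` (gauge set `S = B*` of Lemma 8.9, `|F|_{T_ψ} ≤ C_F w(ψ)`), for a
larger gauge set `S' ⊇ S` (`= B'*`, `B ⊆ B'`) and a weight `w'` with the (w9)-type bound
`e^{‖T'_{S'}φ‖²/2} w(φ) ≤ w'(φ)` (Theorem 7.1 (w9) after `w_{k:k+1}^B ≤ w_{k:k+1}^{B'}`):
`‖F − Π₂F(B)‖_{T'_{S'}, w'} ≤ 1536 C_F c_G`. [cite: AdamsBuchholzKoteckyMuller2019, Lemma 10.4 (10.13)] -/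
theorem tayNormLE_Pi2Rem_of_w9 (hS : ∀ x, x ∈ S ↔ InBox a ρ' x) (ha : InBox a ρ' a)
    (hroom : ∀ x ∈ S, HasRoom a x p) (hp : d / 2 + 2 ≤ p) (hBS : B ⊆ S) (hB : B.card ≠ 0)
    {C₀ : ℝ} (h𝔥 : 0 < 𝔥) (h𝔥' : 0 < 𝔥') (hR : 0 < R) (hL : 1 ≤ L) (hRR : R' = L * R)
    (hκ : 𝔥' ≤ κ * 𝔥) (h𝔥'le : 𝔥' ≤ 𝔥) (hC₁ : 0 ≤ C₁) (hρ : (ρ' : ℝ) ≤ C₁ * R) (hC₀ : 1 ≤ C₀)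
    (hρ0 : (ρ' : ℝ) + (d / 2 + 1 : ℕ) ≤ C₀ * R) (hθ : 𝔥' / 𝔥 * (R / R') ≤ 1) (hr₀ : 3 ≤ r₀)
    (hK : ContDiff ℝ r₀ K) (hloc : IsGaugeLocal (fieldGauge 𝔥 R p S) K)
    {w : ((Fin d → ZMod M) → ℝ) → ℝ} (hw1 : ∀ ψ, 1 ≤ w ψ) (hw0 : w 0 = 1)
    (hwloc : IsGaugeLocal (fieldGauge 𝔥 R p S) w)
    (hwray : ∀ ψ : (Fin d → ZMod M) → ℝ, ∀ t ∈ Set.Icc (0 : ℝ) 1, w (t • ψ) ≤ w ψ)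
    {CF : ℝ} (hCF : 0 ≤ CF) (hKw : ∀ ψ, tayNorm (fieldGauge 𝔥 R p S) r₀ K ψ ≤ CF * w ψ)
    (hSS' : S ⊆ S') {w' : ((Fin d → ZMod M) → ℝ) → ℝ}
    (hw9 : ∀ φ, Real.exp (‖fieldGauge 𝔥' R' p S' φ‖ ^ 2 / 2) * w φ ≤ w' φ) :
    TayNormLE (fieldGauge 𝔥' R' p S') r₀ w' (Pi2Rem a B K)
      (1536 * CF * blockContrConst d 𝔥 𝔥' R R' L κ C₁ C₀) := by
  intro φ
  have hR' : 0 < R' := by rw [hRR]; nlinarith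
  have hp' : d / 2 + 1 ≤ p := by omega
  set cG := blockContrConst d 𝔥 𝔥' R R' L κ C₁ C₀ with hcG
  -- Lemma 10.3 on the smaller gauge set `S`
  have h1 := tayNorm_Pi2Rem_le_weighted hS ha hroom hp hBS hB h𝔥 h𝔥' hR hL hRR hκ h𝔥'le hC₁ hρ hC₀
    hρ0 hθ hr₀ hK hloc hw1 hw0 hwloc hwray hCF hKw φ
  -- `c_G ≥ 0` (it bounds a norm at a point where `w = 1`... we read it off from `h1` at `φ = 0`-free form)
  have hcG0 : 0 ≤ CF * cG := by
    have h0 := tayNorm_Pi2Rem_le_weighted hS ha hroom hp hBS hB h𝔥 h𝔥' hR hL hRR hκ h𝔥'le hC₁ hρ hC₀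
      hρ0 hθ hr₀ hK hloc hw1 hw0 hwloc hwray hCF hKw 0
    rw [map_zero, norm_zero, add_zero, one_pow, mul_one, hw0, mul_one] at h0
    exact (tayNorm_nonneg _ _ _ _).trans h0
  -- pass to the larger gauge set `S'`
  have hloc' : IsGaugeLocal (fieldGauge 𝔥' R' p S) (Pi2Rem a B K) :=
    isGaugeLocal_Pi2Rem h𝔥'.ne' hR'.ne' hp' hBS
      ((isGaugeLocal_fieldGauge_iff h𝔥.ne' hR.ne' h𝔥'.ne' hR'.ne').1 hloc)
  have h2 : tayNorm (fieldGauge 𝔥' R' p S') r₀ (Pi2Rem a B K) φ ≤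
      tayNorm (fieldGauge 𝔥' R' p S) r₀ (Pi2Rem a B K) φ :=
    tayNorm_fieldGauge_anti_set 𝔥' R' p hSS' (contDiff_Pi2Rem hK) hloc' φ
  have h3 : ‖fieldGauge 𝔥' R' p S φ‖ ≤ ‖fieldGauge 𝔥' R' p S' φ‖ :=
    norm_fieldGauge_mono_set 𝔥' R' p hSS' φ
  set t := ‖fieldGauge 𝔥' R' p S' φ‖ with ht
  have ht0 : 0 ≤ t := norm_nonneg _
  have hw0' : 0 ≤ w φ := by linarith [hw1 φ]
  have h4 : (1 + ‖fieldGauge 𝔥' R' p S φ‖) ^ 5 ≤ (1 + t) ^ 5 := by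
    have : 0 ≤ 1 + ‖fieldGauge 𝔥' R' p S φ‖ := by positivity
    gcongr
  have h5 := one_add_pow_five_le ht0
  calc tayNorm (fieldGauge 𝔥' R' p S') r₀ (Pi2Rem a B K) φ
      ≤ CF * cG * (1 + ‖fieldGauge 𝔥' R' p S φ‖) ^ 5 * w φ := h2.trans h1
    _ ≤ CF * cG * (1536 * Real.exp (t ^ 2 / 2)) * w φ := by gcongr; exact h4.trans h5
    _ = 1536 * CF * cG * (Real.exp (t ^ 2 / 2) * w φ) := by ring
    _ ≤ 1536 * CF * cG * w' φ :=
        mul_le_mul_of_nonneg_left (hw9 φ) (by nlinarith [hcG0])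

end SingleBlock

end Literature.MathematicalPhysics.StatisticalMechanics.GradientRG

end
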